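import Summits.HodgeConjecture.HodgeConjecture.Theorems.R90S4TwistedTubeFormula             -- ★ (B1-T) part 3 (R90-C131-p03): §1 `exists_measurable_sheetWeight`, §2 `integrableOn_and_setIntegral_sheetTransversal_eq_setIntegral_cartanWeight_smul` (letter-free)
import Summits.HodgeConjecture.HodgeConjecture.Theorems.R90S4TwistedTubeRadialLoc           -- ★ p864933 part 2b′ (this seat): `integrable_and_integral_epsTube_eq_of_localJacobian` (the (3′) Bochner radial identity)
import HarnessLib

/-!
# R90-TF · S4 «Ch. 13.1–2», T-WIF road, (B1-T) part 3′ — THE TWISTED WEYL INTEGRATION FORMULA OF ONE TUBE UNDER THE LOCAL LETTER (3′):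
# `[Ñ^ε_T : T̃] · ∫_{Ψ(D)} φ β dνGt = ∫_{T^{reg}} D_T(t) • Φ^{st}_ε(sec₀ t, φ) β(sec₀ t) dt_T` (Rogawski 1990, §12.5 p. 186)

Cell `hodgecm-mathlib`, crux H413 (`stmt-HodgeConjecture-24833`, lane `--supports … --as helper`), route of record `HCCMUnconditional` (no route verbs;
count-neutral).  Programme R90-TF, section S4 = [Rogawski1990] Ch. 13.1–13.2; dealer K2E2-plan (g8), S4-R66 (b) (2026-09-05T03:14:05Z); seat K2E3-p12 (g11).  This file is the (3′)
TWIN of R90-C131-p03 (g3)'s part 3 §3 `integrableOn_and_index_mul_setIntegral_epsTube_eq`: the SAME statement with the (J̃♭) letter (3) (hypothesis `hJac`, windows in `T`) replaced by the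
LOCAL letter (3′) (hypothesis `hJacL`, windows in `T̃`; bytes of record = ★ p864933 ∕ the one (J̃♭) socket of C ED. 6), and the SAME conclusion; proof = part 3 §1 (the weight read through the
norm) + ★ part 2b′ §2′ (the Bochner radial identity under (3′)) + part 3 §2 (the letter-free T̃-side computation), by name.  THEOREMS ONLY — no `def`, no instance, no notation, no named-fact
hypothesis, no `sorry`; ★-only imports.  Consumed by the (Σ-head) `R90S4TwistedWeylMeasureOfTubeJacobians` §1 (K2E3-p36 (g4)).

HONEST LABEL: HC_CM is proved only modulo the 7 printed citations (2 remaining named inputs: hLiu418 = stmt-HodgeConjecture-24832, h413 =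
stmt-HodgeConjecture-24833) until rung 0 closes.  CONDITIONAL on the letters (L2) (Borel norm section `s`), the `K_T`-representatives `R`, and (3′) (hypothesis `hJacL`) — discharges no
socket (REL ≠ ★ ≠ BUILT).

## The mathematics

SETTING as in parts 1∕2a∕2b′∕3 (`Φ₃ = splitFormGL L`, `v` non-split; `T = Z_{G_v}(γ₀)`, `T̃ = Cent_{G̃_v}(γ₀)`, ε-regular base point `δ₀ ∈ T̃`, `T′ = G̃_{δ₀ε}` with its normalised Haar measure
`τ′` (`τ′(compact core) = 1`), `μ₀ := νGt ∕ τ′`, `Ψ(xT′, b) = x b ε(x)⁻¹`, `Ñ^ε_T` via `hN'`, norm section `s`, representatives `R`, sheeted transversal `B₀`, `D = {(q, b) | b ∈ B₀}`, the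
sheet measure `λ`, `mGt` canonical for `νGt`, `β` an ε-stable class function, `sec₀` a norm section).  Under (3′): for `φ·β` `νGt`-integrable on the tube `Ψ(D)`,
`t ↦ D_T(t) • (Φ^{st}_ε(sec₀ t, φ) β(sec₀ t))` is `t_T`-integrable on `T^{reg}` and **`[Ñ^ε_T : T̃] · ∫_{Ψ(D)} φ β dνGt = ∫_{T^{reg}} D_T(t) • (Φ^{st}_ε(sec₀ t, φ) · β(sec₀ t)) dt_T`** —
part 3 §1 gives the Borel weight `Wt = cartanWeight T ∘ N̄` with `Wt(s t u) = D_T(t)`, ★ part 2b′ §2′ the Bochner radial identity at `g = φ β` under (3′), part 3 §2 the passage to print's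
variable on `T^{reg}`.

[cite: Rogawski1990, §12.5 p. 186; §4.10 (4.10.1) p. 57; §4.3 (4.3.1) p. 43] [cite: HarishChandra1970, Lemma 22; Lemma 42] [cite: Federer1969, §2.10.10]
-/

set_option autoImplicit false
-- the mandated namespace repeats the single-problem summit's segment (`HodgeConjecture.HodgeConjecture`)
set_option linter.dupNamespace false

noncomputable section

open MeasureTheory Measure Set Filter Topology Function NumberField IsDedekindDomain
open scoped ENNReal NNReal MatrixGroups Pointwise

namespace Summit.HodgeConjecture.HodgeConjecture.R90.S4

open Literature.NumberTheory.Rogawski1990 Literature.NumberTheory.Rogawski1990.Ch4Sec10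
open Literature.NumberTheory.Automorphic Literature.NumberTheory.Automorphic.UnitaryGroup
open Literature.MeasureTheory.Group
open Summit.HodgeConjecture.HodgeConjecture.Cruxes.H413.F0P3cStCharTSWeylCartanRadial

section FormulaLoc

variable {L : Type} [Field L] [NumberField L] [IsCMField L] {v : HeightOneSpectrum (𝓞 ↥(maximalRealSubfield L))}
  (hns : ∀ w : PlacesOver L v, IsCMField.complexConj L • w.1 = w.1)
  {T : Subgroup ((UnitaryGroup.cmDatum L 3 (splitFormGL L : Matrix (Fin 3) (Fin 3) L)).Local v)}
  {γ₀ : (UnitaryGroup.cmDatum L 3 (splitFormGL L : Matrix (Fin 3) (Fin 3) L)).Local v} (hγ₀ : IsRegularElt (γ₀.val : GtLoc L v))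
  (hT : T = Subgroup.centralizer ({γ₀} : Set ((UnitaryGroup.cmDatum L 3 (splitFormGL L : Matrix (Fin 3) (Fin 3) L)).Local v)))
  [LocallyCompactSpace (GtLoc L v)] [SecondCountableTopology (GtLoc L v)] [T2Space (GtLoc L v)] [MeasurableSpace (GtLoc L v)] [BorelSpace (GtLoc L v)]
  [∀ δ : GtLoc L v, MeasurableSpace (GtLoc L v ⧸ epsCentralizer (epsLoc L (splitFormGL L) v) δ)]
  [∀ δ : GtLoc L v, BorelSpace (GtLoc L v ⧸ epsCentralizer (epsLoc L (splitFormGL L) v) δ)]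
  [MeasurableSpace ((UnitaryGroup.cmDatum L 3 (splitFormGL L : Matrix (Fin 3) (Fin 3) L)).Local v)] [BorelSpace ((UnitaryGroup.cmDatum L 3 (splitFormGL L : Matrix (Fin 3) (Fin 3) L)).Local v)]
  {δ₀ : GtLoc L v} (hδ₀T : δ₀ ∈ Subgroup.centralizer ({(γ₀.val : GtLoc L v)} : Set (GtLoc L v))) (hδ₀reg : IsEpsRegularAt L (splitFormGL L) v δ₀)
  (Ψ : (GtLoc L v ⧸ epsCentralizer (epsLoc L (splitFormGL L) v) δ₀) × ↥(Subgroup.centralizer ({(γ₀.val : GtLoc L v)} : Set (GtLoc L v))) → GtLoc L v)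
  (hΨ : ∀ (x : GtLoc L v) (b : ↥(Subgroup.centralizer ({(γ₀.val : GtLoc L v)} : Set (GtLoc L v)))), Ψ (QuotientGroup.mk x, b) = x * b * (epsLoc L (splitFormGL L) v x)⁻¹)
  (N' : Subgroup (GtLoc L v))
  (hN' : ∀ m, m ∈ N' ↔ m ∈ Subgroup.normalizer ((Subgroup.centralizer ({(γ₀.val : GtLoc L v)} : Set (GtLoc L v)) : Subgroup (GtLoc L v)) : Set (GtLoc L v)) ∧
    m * (epsLoc L (splitFormGL L) v m)⁻¹ ∈ Subgroup.centralizer ({(γ₀.val : GtLoc L v)} : Set (GtLoc L v)))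
  (s : ↥T → ↥(Subgroup.centralizer ({(γ₀.val : GtLoc L v)} : Set (GtLoc L v)))) (hsm : Measurable s)
  (hsN : ∀ t : ↥T, epsNorm (epsLoc L (splitFormGL L) v) (s t : GtLoc L v) = ((t : (UnitaryGroup.cmDatum L 3 (splitFormGL L : Matrix (Fin 3) (Fin 3) L)).Local v)).val)
  (R : Finset ↥(Subgroup.centralizer ({(γ₀.val : GtLoc L v)} : Set (GtLoc L v))))
  (hRN : ∀ u ∈ R, epsNorm (epsLoc L (splitFormGL L) v) (u : GtLoc L v) = 1)
  (hRcov : ∀ w : ↥(Subgroup.centralizer ({(γ₀.val : GtLoc L v)} : Set (GtLoc L v))), epsNorm (epsLoc L (splitFormGL L) v) (w : GtLoc L v) = 1 →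
    ∃ u ∈ R, ∃ a : ↥(Subgroup.centralizer ({(γ₀.val : GtLoc L v)} : Set (GtLoc L v))), (w : GtLoc L v) = u * (a * (epsLoc L (splitFormGL L) v a)⁻¹))
  (hRinj : ∀ u ∈ R, ∀ u' ∈ R, (∃ a : ↥(Subgroup.centralizer ({(γ₀.val : GtLoc L v)} : Set (GtLoc L v))),
    ((u' : ↥(Subgroup.centralizer ({(γ₀.val : GtLoc L v)} : Set (GtLoc L v)))) : GtLoc L v) = u * (a * (epsLoc L (splitFormGL L) v a)⁻¹)) → u = u')
  (tT : Measure ↥T) [SigmaFinite tT]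
  (τ' : Measure ↥(epsCentralizer (epsLoc L (splitFormGL L) v) δ₀)) [τ'.IsHaarMeasure] [τ'.IsInvInvariant]

/-! ## The formula of one tube under the local letter (3′) -/

set_option maxHeartbeats 800000 in
-- instance-term unification on the CM local carrier, as in ★ (E1b) and part 3 §3
include hns hγ₀ hT hδ₀T hδ₀reg hΨ hN' hsm hsN hRN hRcov hRinj in
/-- **THE TWISTED WEYL INTEGRATION FORMULA OF ONE TUBE, UNDER THE LOCAL LETTER (3′)** (Rogawski p. 186 for a single Cartan `T`): under (3′) (hypothesis `hJacL`, bytes of record ★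
p864933 = the one (J̃♭) socket body of C ED. 6), with `mGt` canonical for `νGt` and `τ′(compact core of T′) = 1`, for `φ·β` `νGt`-integrable on the tube `Ψ(D)`, `β` an ε-stable class function
and `sec₀` a norm section: `t ↦ D_T(t) • (Φ^{st}_ε(sec₀ t, φ) β(sec₀ t))` is `t_T`-integrable on `T^{reg}` and
**`[Ñ^ε_T : T̃] · ∫_{Ψ(D)} φ β dνGt = ∫_{T^{reg}} D_T(t) • (Φ^{st}_ε(sec₀ t, φ) · β(sec₀ t)) dt_T`** — same conclusion bytes as part 3 §3, one binder changed (`hJac ↦ hJacL`); proof = part 3 §1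
+ ★ part 2b′ §2′ + part 3 §2. [cite: Rogawski1990, §12.5 p. 186; §4.10 (4.10.1) p. 57] [cite: HarishChandra1970, Lemma 42] [cite: Federer1969, §2.10.10] -/
theorem integrableOn_and_index_mul_setIntegral_epsTube_eq_of_localJacobian (νGt : Measure (GtLoc L v)) [νGt.IsHaarMeasure] [νGt.IsMulRightInvariant]
    (mGt : EpsOrbitalMeasureFamily (epsLoc L (splitFormGL L) v) ⊥) (hcan : IsEpsCanonicalAt L (splitFormGL L) v νGt mGt)
    (h1 : τ' (compactCore ↥(epsCentralizer (epsLoc L (splitFormGL L) v) δ₀)) = 1)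
    (hJacL : ∀ b₁ ∈ {b : ↥(Subgroup.centralizer ({(γ₀.val : GtLoc L v)} : Set (GtLoc L v))) | ∃ t : ↥T, IsRegularElt (((t : (UnitaryGroup.cmDatum L 3 (splitFormGL L : Matrix (Fin 3) (Fin 3) L)).Local v)).val : GtLoc L v) ∧ ∃ u ∈ R, b = s t * u},
      ∃ U' : Set ↥(Subgroup.centralizer ({(γ₀.val : GtLoc L v)} : Set (GtLoc L v))), IsOpen U' ∧ b₁ ∈ U' ∧
      ∃ A₀ : Set (GtLoc L v ⧸ epsCentralizer (epsLoc L (splitFormGL L) v) δ₀), MeasurableSet A₀ ∧ (quotientMeasure (epsCentralizer (epsLoc L (splitFormGL L) v) δ₀) τ' (isClosed_epsCentralizer L (splitFormGL L) v δ₀) νGt) A₀ ≠ 0 ∧ (quotientMeasure (epsCentralizer (epsLoc L (splitFormGL L) v) δ₀) τ' (isClosed_epsCentralizer L (splitFormGL L) v δ₀) νGt) A₀ ≠ ⊤ ∧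
        ∀ u ∈ R, ∀ V : Set ↥T, MeasurableSet V → V ⊆ {t : ↥T | IsRegularElt (((t : (UnitaryGroup.cmDatum L 3 (splitFormGL L : Matrix (Fin 3) (Fin 3) L)).Local v)).val : GtLoc L v)} →
          (fun t : ↥T => s t * u) '' V ⊆ U' →
          νGt (Ψ '' (A₀ ×ˢ ((fun t : ↥T => s t * u) '' V))) = (quotientMeasure (epsCentralizer (epsLoc L (splitFormGL L) v) δ₀) τ' (isClosed_epsCentralizer L (splitFormGL L) v δ₀) νGt) A₀ * ∫⁻ t in V, (cartanWeight L v T t : ℝ≥0∞) ∂tT)    (φ β : GtLoc L v → ℂ) (hφβ : IntegrableOn (fun y => φ y * β y) (Ψ '' {p | p.2 ∈ {b : ↥(Subgroup.centralizer ({(γ₀.val : GtLoc L v)} : Set (GtLoc L v))) | ∃ t : ↥T, IsRegularElt (((t : (UnitaryGroup.cmDatum L 3 (splitFormGL L : Matrix (Fin 3) (Fin 3) L)).Local v)).val : GtLoc L v) ∧ ∃ u ∈ R, b = s t * u}}) νGt)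
    (hβ : ∀ δ δ' : GtLoc L v, IsStablyEpsConjAt L (splitFormGL L) v δ δ' → β δ = β δ')
    (sec₀ : (UnitaryGroup.cmDatum L 3 (splitFormGL L : Matrix (Fin 3) (Fin 3) L)).Local v → GtLoc L v) (hsec₀ : ∀ γ, IsEpsNormPair L (splitFormGL L) v (sec₀ γ) γ) :
    IntegrableOn (fun t : ↥T => (cartanWeight L v T t : ℝ) •
        (stableEpsOrbitalIntegral L (splitFormGL L) v mGt φ (sec₀ (t : (UnitaryGroup.cmDatum L 3 (splitFormGL L : Matrix (Fin 3) (Fin 3) L)).Local v)) * β (sec₀ (t : (UnitaryGroup.cmDatum L 3 (splitFormGL L : Matrix (Fin 3) (Fin 3) L)).Local v)))) {t : ↥T | IsRegularElt (((t : (UnitaryGroup.cmDatum L 3 (splitFormGL L : Matrix (Fin 3) (Fin 3) L)).Local v)).val : GtLoc L v)} tT ∧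
    (((((Subgroup.centralizer ({(γ₀.val : GtLoc L v)} : Set (GtLoc L v))).subgroupOf N').index : ℕ) : ℂ) * ∫ y in Ψ '' {p | p.2 ∈ {b : ↥(Subgroup.centralizer ({(γ₀.val : GtLoc L v)} : Set (GtLoc L v))) | ∃ t : ↥T, IsRegularElt (((t : (UnitaryGroup.cmDatum L 3 (splitFormGL L : Matrix (Fin 3) (Fin 3) L)).Local v)).val : GtLoc L v) ∧ ∃ u ∈ R, b = s t * u}}, φ y * β y ∂νGt =
      ∫ t in {t : ↥T | IsRegularElt (((t : (UnitaryGroup.cmDatum L 3 (splitFormGL L : Matrix (Fin 3) (Fin 3) L)).Local v)).val : GtLoc L v)}, (cartanWeight L v T t : ℝ) •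
        (stableEpsOrbitalIntegral L (splitFormGL L) v mGt φ (sec₀ (t : (UnitaryGroup.cmDatum L 3 (splitFormGL L : Matrix (Fin 3) (Fin 3) L)).Local v)) * β (sec₀ (t : (UnitaryGroup.cmDatum L 3 (splitFormGL L : Matrix (Fin 3) (Fin 3) L)).Local v))) ∂tT) := by
  obtain ⟨Wt, hWtm, hWt⟩ := exists_measurable_sheetWeight hns hγ₀ hT s hsN R hRN
  obtain ⟨hInt, hEq⟩ := integrable_and_integral_epsTube_eq_of_localJacobian hns hγ₀ hT hδ₀T hδ₀reg Ψ hΨ N' hN' s hsm hsN R hRN hRcov hRinj tT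
    Wt hWtm hWt τ' νGt hJacL (fun y => φ y * β y) hφβ
  have hG := integrable_sheetWeight_smul_integral_of_prod Ψ s R tT τ' νGt Wt hWtm (fun y => φ y * β y) hInt
  obtain ⟨hint, hrad⟩ := integrableOn_and_setIntegral_sheetTransversal_eq_setIntegral_cartanWeight_smul hns hγ₀ hT hδ₀T hδ₀reg Ψ hΨ s hsm hsN R hRN hRcov hRinj
    tT τ' νGt mGt hcan h1 Wt hWt φ β hβ sec₀ hsec₀ hG
  refine ⟨hint, ?_⟩
  rw [← hrad, hEq, Complex.real_smul, Complex.ofReal_natCast]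

end FormulaLoc

end Summit.HodgeConjecture.HodgeConjecture.R90.S4

end
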